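import Summits.Ventures.Crystal3D.Theorems.StickyWulffConstantTextureBuildHealWindow
import HarnessLib

/-!
# TB-1 brick L-HEAL, cluster form: heal MANY bounded defect clusters of MANY grains at once (one surgery, one `x'`)
# (lane T, crux `TextureLiminfV5`, stmt-Ventures-23912; blueprint HOME/wulff-p2/g23/TB-COVER-BLUEPRINT-g23.md step S3 «selection», cf-p1 (ccxciv)(2))

HONEST FRAMING. Venture `Summits/Ventures/Crystal3D` (cell `crystal3d-full`), route `route-Ventures-StickyWulffConstant`, helper `--supports` the
law-v5 crux `TextureLiminfV5` (stmt-Ventures-23912).  Pure finite combinatorics over '…TextureBuildHeal' / '…HealLabelled' / '…HealWindow' (census-free,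
standard axioms).  Nothing about any cover or texture is claimed; F-C1 not moved.

WHY.  The healed binder `CoverH` of `stub_TB_cover` (TexShadow v8.24) builds the TB-cover on ONE healed packing `x'` of the whole cluster, while the
defects to heal sit in many grains `f : ι`, each with its own moved Barlow stacking `S_f`.  '…HealWindow' heals one round window of one grain.  This file
is the form the multi-grain constructor consumes: an arbitrary finite family of CLUSTER SETS `P f ⊆ E3` (the bad points grain `f` wants healed), one
simultaneous surgery on `B := ⋃_f {y | dist(y, P f) ≤ 1}` refilling `S_f` inside `{dist(·, P f) ≤ 1}`.

**`exists_healed_clusters`.**  Let `x` be a unit packing, `S_f` moved Barlow stackings, `P f` bounded sets, pairwise MORE THAN `4` APART across grains, and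
suppose every grain's cluster set is CLOSED at range `2`: a ball within `2` of `P f` and not in `P f` lies on `S_f` (`hc1`) and has all its twelve
`S_f`-neighbours occupied (`hc2`), and an `S_f`-site within `2` of `P f` and not in `P f` is occupied (`hc3`) — i.e. every defect of grain `f` within `2`
of `P f` belongs to `P f`.  Then there is a unit packing `x' : Fin N' → E3` with
* `6N' − b(x') ≤ 6N − b(x)` (abstract heal `contactDeficiency_heal_le_of_degrees`: new sites fully coordinated, kept balls lose nothing);
* `range x' = (range x ∖ B) ∪ ⋃_f (S_f ∩ {dist(·, P f) ≤ 1})` (membership form `hrange`);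
* COMPLETE and CLEAN near the clusters: every `S_f`-site within `2` of `P f` is a ball of `x'`, every ball of `x'` within `2` of `P f` lies on `S_f`;
* `N ≤ N' + #{i | ∃ f, dist(x i, P f) ≤ 1 ∧ x i ∉ S_f}` — only balls OFF their cluster's lattice are lost.
The selection of the `P f` (which defects are far enough from walls to have closed cluster sets, and why the lost balls are `o(N)`) is the sequel.
-/

noncomputable section

namespace Summit.Ventures.Crystal3D.Theorems

open Finset Summit.Ventures.Crystal3D
open Literature.MathematicalPhysics.StatisticalMechanics (IsHaggSeq contactDeficiency)
open Summit.Ventures.Crystal3D.Cruxes.TextureLiminf.TexShadow (E3 stacking one_le_dist_of_mem_stacking)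

section Clusters

variable {N : ℕ} {x : Fin N → E3} {ι : Type*} [Fintype ι]
  {L : ι → (E3 ≃ₗᵢ[ℝ] E3)} {s : ι → E3} {σ : ι → ℤ → ℤ} {P : ι → Set E3}

open scoped Classical in
/-- **HEALING A FAMILY OF CLOSED, SEPARATED DEFECT CLUSTERS.**  See the module docstring. -/
theorem exists_healed_clusters (hx : IsUnitPacking x) (hσ : ∀ f, IsHaggSeq (σ f))
    (hPbdd : ∀ f, Bornology.IsBounded (P f))
    (hsep : ∀ f g, f ≠ g → ∀ p ∈ P f, ∀ q ∈ P g, 4 < dist p q)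
    (hc1 : ∀ f i, (∃ p ∈ P f, dist (x i) p ≤ 2) → x i ∉ P f → x i ∈ stacking (L f) (s f) (σ f))
    (hc2 : ∀ f i, (∃ p ∈ P f, dist (x i) p ≤ 2) → x i ∉ P f →
      ∀ w ∈ stacking (L f) (s f) (σ f), dist (x i) w = 1 → w ∈ Set.range x)
    (hc3 : ∀ f, ∀ w ∈ stacking (L f) (s f) (σ f), (∃ p ∈ P f, dist w p ≤ 2) → w ∉ P f → w ∈ Set.range x) :
    ∃ (N' : ℕ) (x' : Fin N' → E3), IsUnitPacking x' ∧
      6 * (N' : ℝ) - (numContacts x' : ℝ) ≤ 6 * (N : ℝ) - (numContacts x : ℝ) ∧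
      (∀ y, y ∈ Set.range x' ↔
        (y ∈ Set.range x ∧ ∀ f, ∀ p ∈ P f, 1 < dist y p) ∨
        (∃ f, y ∈ stacking (L f) (s f) (σ f) ∧ ∃ p ∈ P f, dist y p ≤ 1)) ∧
      (∀ f, ∀ w ∈ stacking (L f) (s f) (σ f), (∃ p ∈ P f, dist w p ≤ 2) → w ∈ Set.range x') ∧
      (∀ f j, (∃ p ∈ P f, dist (x' j) p ≤ 2) → x' j ∈ stacking (L f) (s f) (σ f)) ∧
      N ≤ N' + (Finset.univ.filter fun i =>
        ∃ f, (∃ p ∈ P f, dist (x i) p ≤ 1) ∧ x i ∉ stacking (L f) (s f) (σ f)).card := by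
  classical
  -- the point set of `x`
  set X : Finset E3 := Finset.univ.image x with hXdef
  have hXsep := image_sep hx
  have hmemX : ∀ {a : E3}, a ∈ X ↔ a ∈ Set.range x := fun {a} => by
    rw [hXdef]; exact mem_image_univ_iff_mem_range
  -- stackings, unit neighbourhoods of the clusters, the surgery region
  let S : ι → Set E3 := fun f => stacking (L f) (s f) (σ f)
  let Bf : ι → Set E3 := fun f => {y | ∃ p ∈ P f, dist y p ≤ 1}
  let B : Set E3 := {y | ∃ f, y ∈ Bf f}
  have hPB : ∀ f, ∀ p ∈ P f, p ∈ Bf f := fun f p hp => ⟨p, hp, by rw [dist_self]; exact zero_le_one⟩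
  -- radii and the (finite) sets of new sites
  have hrad : ∀ f, ∃ r : ℝ, P f ⊆ Metric.closedBall (0 : E3) r := fun f =>
    (Metric.isBounded_iff_subset_closedBall 0).1 (hPbdd f)
  choose r hr using hrad
  have hBf_ball : ∀ f, ∀ y ∈ Bf f, y ∈ Metric.closedBall (0 : E3) (r f + 1) := by
    rintro f y ⟨p, hp, hyp⟩
    have := hr f hp
    rw [Metric.mem_closedBall] at this ⊢
    calc dist y 0 ≤ dist y p + dist p 0 := dist_triangle _ _ _
      _ ≤ 1 + r f := add_le_add hyp this
      _ = r f + 1 := add_comm _ _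
  have hfin : ∀ f, (S f ∩ Metric.closedBall (0 : E3) (r f + 1)).Finite := fun f =>
    finite_stacking_inter_closedBall (hσ f) 0 (r f + 1)
  let Vf : ι → Finset E3 := fun f => (hfin f).toFinset.filter fun v => v ∈ Bf f
  let V : Finset E3 := Finset.univ.biUnion Vf
  have hVf : ∀ f v, v ∈ Vf f ↔ v ∈ S f ∧ v ∈ Bf f := by
    intro f v
    constructor
    · intro hv
      obtain ⟨hv1, hv2⟩ := Finset.mem_filter.1 hv
      exact ⟨((Set.Finite.mem_toFinset (hfin f)).1 hv1).1, hv2⟩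
    · rintro ⟨hvS, hvB⟩
      exact Finset.mem_filter.2 ⟨(Set.Finite.mem_toFinset (hfin f)).2 ⟨hvS, hBf_ball f v hvB⟩, hvB⟩
  have hV : ∀ v, v ∈ V ↔ ∃ f, v ∈ S f ∧ v ∈ Bf f := by
    intro v
    constructor
    · intro hv
      obtain ⟨f, -, hvf⟩ := Finset.mem_biUnion.1 hv
      exact ⟨f, (hVf f v).1 hvf⟩
    · rintro ⟨f, hvf⟩
      exact Finset.mem_biUnion.2 ⟨f, Finset.mem_univ _, (hVf f v).2 hvf⟩
  have hVB : ∀ v ∈ V, v ∈ B := fun v hv => by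
    obtain ⟨f, -, hvB⟩ := (hV v).1 hv
    exact ⟨f, hvB⟩
  -- separation: a point within `3` of `P f` is not within `1` of another cluster set
  have hfar : ∀ f g, f ≠ g → ∀ y, (∃ p ∈ P f, dist y p ≤ 3) → y ∉ Bf g := by
    rintro f g hfg y ⟨p, hp, hyp⟩ ⟨q, hq, hyq⟩
    have h4 := hsep f g hfg p hp q hq
    have : dist p q ≤ dist p y + dist y q := dist_triangle _ _ _
    rw [dist_comm p y] at this
    linarith
  -- a kept ball within `2` of `P f` is an `S f`-site with all twelve `S f`-neighbours occupied
  have hgood : ∀ f i, (∃ p ∈ P f, dist (x i) p ≤ 2) → x i ∉ B →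
      x i ∈ S f ∧ ∀ w ∈ S f, dist (x i) w = 1 → w ∈ Set.range x := by
    intro f i hnear hiB
    have hiP : x i ∉ P f := fun h => hiB ⟨f, hPB f _ h⟩
    exact ⟨hc1 f i hnear hiP, hc2 f i hnear hiP⟩
  -- the twelve `S f`-neighbours of a point within `2` of `P f` are in the healed configuration, provided they are balls or in `Bf f`
  have htwelve : ∀ f (a : E3), (∃ p ∈ P f, dist a p ≤ 2) → a ∈ S f →
      (∀ w ∈ S f, dist a w = 1 → w ∉ Bf f → w ∈ Set.range x) → 12 ≤ cdeg (heal X V B) a := by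
    intro f a hnear haS hocc
    refine twelve_le_cdeg_of_touching_subset (hσ f) haS fun w hw hdw => ?_
    rw [mem_heal]
    by_cases hwB : w ∈ Bf f
    · exact Or.inr ((hV w).2 ⟨f, hw, hwB⟩)
    · refine Or.inl ⟨hmemX.2 (hocc w hw hdw hwB), ?_⟩
      rintro ⟨g, hwg⟩
      by_cases hgf : g = f
      · subst hgf; exact hwB hwg
      · obtain ⟨p, hp, hap⟩ := hnear
        refine hfar f g (Ne.symm hgf) w ⟨p, hp, ?_⟩ hwg
        calc dist w p ≤ dist w a + dist a p := dist_triangle _ _ _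
          _ ≤ 1 + 2 := add_le_add (by rw [dist_comm, hdw]) hap
          _ = 3 := by norm_num
  -- new sites are fully coordinated
  have hfull : ∀ v ∈ V, 12 ≤ cdeg (heal X V B) v := by
    intro v hv
    obtain ⟨f, hvS, p, hp, hvp⟩ := (hV v).1 hv
    refine htwelve f v ⟨p, hp, by linarith⟩ hvS fun w hw hdw hwB => ?_
    refine hc3 f w hw ⟨p, hp, ?_⟩ fun h => hwB (hPB f w h)
    calc dist w p ≤ dist w v + dist v p := dist_triangle _ _ _
      _ ≤ 1 + 1 := add_le_add (by rw [dist_comm, hdw]) hvp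
      _ = 2 := by norm_num
  -- kept balls do not lose degree
  have hkept : ∀ a ∈ X, a ∉ B → cdeg X a ≤ cdeg (heal X V B) a := by
    intro a haX haB
    obtain ⟨i, rfl⟩ := hmemX.1 haX
    by_cases htouch : ∃ y, y ∈ B ∧ dist (x i) y ≤ 1
    · obtain ⟨y, ⟨f, p, hp, hyp⟩, hd⟩ := htouch
      have hnear : ∃ p ∈ P f, dist (x i) p ≤ 2 :=
        ⟨p, hp, by linarith [dist_triangle (x i) y p]⟩
      obtain ⟨hiS, hocc⟩ := hgood f i hnear haB
      exact (cdeg_le_twelve X hXsep (x i)).trans (htwelve f (x i) hnear hiS fun w hw hdw _ => hocc w hw hdw)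
    · push Not at htouch
      unfold cdeg
      refine Finset.card_le_card fun q hq => ?_
      rw [Finset.mem_filter] at hq ⊢
      refine ⟨(mem_heal X V B).2 (Or.inl ⟨hq.1, fun hqB => ?_⟩), hq.2⟩
      have := htouch q hqB
      linarith [hq.2]
  -- the healed point set is `1`-separated
  have hsep' : ∀ p ∈ heal X V B, ∀ q ∈ heal X V B, p ≠ q → 1 ≤ dist p q := by
    -- a kept ball and a new site
    have hmixed : ∀ a ∈ X, a ∉ B → ∀ v ∈ V, 1 ≤ dist a v := by
      intro a haX haB v hv
      obtain ⟨i, rfl⟩ := hmemX.1 haX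
      obtain ⟨f, hvS, p, hp, hvp⟩ := (hV v).1 hv
      by_contra hlt
      push Not at hlt
      have hnear : ∃ p ∈ P f, dist (x i) p ≤ 2 := ⟨p, hp, by linarith [dist_triangle (x i) v p]⟩
      have hiS := (hgood f i hnear haB).1
      have hne : x i ≠ v := fun h => haB (h ▸ hVB v hv)
      exact absurd (one_le_dist_of_mem_stacking (hσ f) hiS hvS hne) (not_le.2 hlt)
    intro p hp q hq hpq
    rw [mem_heal] at hp hq
    rcases hp with ⟨hpX, hpB⟩ | hpV <;> rcases hq with ⟨hqX, hqB⟩ | hqV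
    · exact hXsep p hpX q hqX hpq
    · exact hmixed p hpX hpB q hqV
    · rw [dist_comm]; exact hmixed q hqX hqB p hpV
    · obtain ⟨f, hpS, p₁, hp₁, hpp₁⟩ := (hV p).1 hpV
      obtain ⟨g, hqS, q₁, hq₁, hqq₁⟩ := (hV q).1 hqV
      by_cases hfg : f = g
      · subst hfg
        exact one_le_dist_of_mem_stacking (hσ f) hpS hqS hpq
      · have h4 := hsep f g hfg p₁ hp₁ q₁ hq₁
        have := dist_triangle4 p₁ p q q₁
        rw [dist_comm p₁ p] at this
        linarith
  -- enumerate the healed point set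
  obtain ⟨x', hx', himg⟩ := exists_enum_of_separated (heal X V B) hsep'
  have hmem' : ∀ {a : E3}, a ∈ Set.range x' ↔ a ∈ heal X V B := fun {a} => by
    have h := (mem_image_univ_iff_mem_range (f := x') (b := a)).symm
    rw [himg] at h
    exact h
  -- the membership form of `range x'`
  have hnotB : ∀ y, y ∉ B ↔ ∀ f, ∀ p ∈ P f, 1 < dist y p := by
    intro y
    constructor
    · intro h f p hp
      by_contra hle
      push Not at hle
      exact h ⟨f, p, hp, hle⟩
    · rintro h ⟨f, p, hp, hyp⟩
      exact absurd (h f p hp) (not_lt.2 hyp)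
  have hrange : ∀ y, y ∈ Set.range x' ↔
      (y ∈ Set.range x ∧ ∀ f, ∀ p ∈ P f, 1 < dist y p) ∨ (∃ f, y ∈ S f ∧ ∃ p ∈ P f, dist y p ≤ 1) := by
    intro y
    rw [hmem', mem_heal, hnotB y, hV, hmemX]
    exact Iff.rfl
  refine ⟨(heal X V B).card, x', hx', ?_, hrange, ?_, ?_, ?_⟩
  · -- deficiency
    rw [← contactDeficiency_image_eq x hx.injective, ← contactDeficiency_image_eq x' hx'.injective, himg]
    exact contactDeficiency_heal_le_of_degrees hXsep hVB hfull hkept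
  · -- complete near the clusters
    rintro f w hw ⟨p, hp, hwp⟩
    rw [hrange]
    by_cases hwB : w ∈ Bf f
    · exact Or.inr ⟨f, hw, hwB⟩
    · have hwP : w ∉ P f := fun h => hwB (hPB f w h)
      refine Or.inl ⟨hc3 f w hw ⟨p, hp, hwp⟩ hwP, fun g q hq => ?_⟩
      by_contra hle
      push Not at hle
      by_cases hgf : g = f
      · subst hgf; exact hwB ⟨q, hq, hle⟩
      · exact hfar f g (Ne.symm hgf) w ⟨p, hp, by linarith⟩ ⟨q, hq, hle⟩
  · -- clean near the clusters
    rintro f j ⟨p, hp, hjp⟩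
    rcases (hrange (x' j)).1 ⟨j, rfl⟩ with ⟨⟨i, hi⟩, hfarj⟩ | ⟨g, hgS, q, hq, hjq⟩
    · have hiB : x i ∉ B := by
        rintro ⟨g, q, hq, hiq⟩
        rw [hi] at hiq
        exact absurd (hfarj g q hq) (not_lt.2 hiq)
      have := (hgood f i ⟨p, hp, by rw [hi]; exact hjp⟩ hiB).1
      rw [hi] at this
      exact this
    · by_cases hgf : g = f
      · subst hgf; exact hgS
      · exact absurd ⟨q, hq, hjq⟩ (hfar f g (Ne.symm hgf) (x' j) ⟨p, hp, by linarith⟩)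
  · -- count: `#X = #kept + #(X ∩ B)`, `#heal = #kept + #V`, and a ball of `X ∩ B` off its cluster's lattice is lost, the others are in `V`
    have hN : N = X.card := (card_image_univ_eq x hx.injective).symm
    have hKV : Disjoint (X.filter fun a => a ∉ B) V := by
      rw [Finset.disjoint_left]
      intro a haK haV
      exact (Finset.mem_filter.1 haK).2 (hVB a haV)
    have hheal : (heal X V B).card = (X.filter fun a => a ∉ B).card + V.card := by
      unfold heal; rw [Finset.card_union_of_disjoint hKV]
    have h1 : (X.filter fun a => a ∉ B).card + (X.filter fun a => a ∈ B).card = X.card := by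
      rw [add_comm]; exact Finset.card_filter_add_card_filter_not (fun a => a ∈ B)
    set Lost : Finset (Fin N) := Finset.univ.filter fun i =>
      ∃ f, (∃ p ∈ P f, dist (x i) p ≤ 1) ∧ x i ∉ stacking (L f) (s f) (σ f) with hLost
    have h2 : (X.filter fun a => a ∈ B) ⊆ V ∪ Lost.image x := by
      intro a ha
      obtain ⟨haX, f, hfB⟩ := Finset.mem_filter.1 ha
      obtain ⟨i, rfl⟩ := hmemX.1 haX
      rw [Finset.mem_union]
      by_cases hiS : x i ∈ S f
      · exact Or.inl ((hV _).2 ⟨f, hiS, hfB⟩)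
      · exact Or.inr (Finset.mem_image.2 ⟨i, Finset.mem_filter.2 ⟨Finset.mem_univ _, f, hfB, hiS⟩, rfl⟩)
    have h3a := Finset.card_le_card h2
    have h3b := Finset.card_union_le V (Lost.image x)
    have h3c : (Lost.image x).card ≤ Lost.card := Finset.card_image_le
    omega

end Clusters

end Summit.Ventures.Crystal3D.Theorems

end
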